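import Mathlib
import Summits.Ventures.PercRepro2.Defs
import Summits.Ventures.PercRepro2.Graph
import Summits.Ventures.PercRepro2.OneColourSwitch
import Summits.Ventures.PercRepro2.M9NoPocketDefs
import Summits.Ventures.PercRepro2.M9PocketProdPoint
import Summits.Ventures.PercRepro2.M9PocketProdWorlds
import Summits.Ventures.PercRepro2.M9PocketProdMono
import Summits.Ventures.PercRepro2.M9PocketProdLink
import Summits.Ventures.PercRepro2.M9PocketUnitFibreSumT
import Summits.Ventures.PercRepro2.M9PocketProdWorldsT

/-!
# [`T`-edge chain] # The product fibre of a skeleton: `σ_rs` is constant without linking free blocks (blind cell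
PercRepro2, p3 g39, 2026-08-29; `proofs/P3-POCKETRK.md` §8′ and §10 (d): the free-block
extension, part 5)

When no switchable block is adjacent to both `r` and `s` (`h𝔉nl`), the link sign is the same
at every point of the product fibre: there is no `W`-link (`not_conn_compl_rs_prod`: the
`W`-cluster of `r` is `r` with the switched blocks rooted at `r`), and the `Y`-link is that of
the skeleton (`conn_rs_prod_of_conn_rs`, `conn_rs_of_conn_rs_prod`: a `Y`-path from `r` at
`φ S` uses fixed edges inside `Z(S)`; a `Y`-path at `ρ` enters a switched block only through
its root and, the block being non-linking, leaves it through the same root — the detour is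
shortcut).  Hence `sigma_rs_prod_eq`.  T-VARIANT (p3 g39, `proofs/P3-POCKETRK.md` §10‴): the hypothesis «no `d r`, `d s` edge» is
replaced by `hM : d ∉ M₂(ρ)` (every `T`-edge is `Y` at a `K`-only point); the lemmas carry the
suffix `_T`, the `hT`-free lemmas are those of the original file.  Own work; std axioms.
-/

namespace Summit.Ventures.PercRepro2

namespace NoPocket

open Finset Classical OneColourSwitch SideSwitch

variable {V : Type*} {E : Type*} {ends : E → Sym2 V} {p q r s d : V} {ρ : Config E}
  {𝔉 : Finset (Finset V)} {R : Finset E}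

section Link

variable (hdr : d ≠ r) (hds : d ≠ s) (hrs : within ends ({r, s} : Set V) = ∅)
  (hM : d ∉ M2 ends r s ρ)
  (hsep : sep2 ends p q r s ρ) (hD : DOne ends r s d ρ) (hK : d ∈ K2 ends r s ρ)
  (hB : ∀ x ∈ M2 (endsD ends d) r s ρ, x = r ∨ x = s)
  (hR : ∀ e, e ∈ R ↔ e ∉ touches ends (cluster ends ρ d ∪ K2 (endsD ends d) r s ρ ∪
    M2 (endsD ends d) r s ρ))
  (h𝔉K : ∀ C ∈ 𝔉, (↑C : Set V) ⊆ K2 (endsD ends d) r s ρ)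
  (h𝔉r : ∀ C ∈ 𝔉, r ∉ C) (h𝔉s : ∀ C ∈ 𝔉, s ∉ C)
  (h𝔉cl : ∀ C ∈ 𝔉, ClosedIn (endsD ends d) (sided (endsD ends d) r s ρ) (↑C : Set V))
  (h𝔉d : ∀ C ∈ 𝔉, ∀ e y, y ∈ C → ends e ≠ s(d, y))
  (h𝔉pk : ∀ C ∈ 𝔉, ∀ e x y, ends e = s(x, y) → x ∈ C → y ∈ cluster ends ρ d →
    y ∈ C ∨ y = r ∨ y = s)
  (h𝔉nl : ∀ C ∈ 𝔉, (∀ e y, y ∈ C → ends e ≠ s(r, y)) ∨ (∀ e y, y ∈ C → ends e ≠ s(s, y)))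
  (S : Finset ({C // C ∈ 𝔉} ⊕ {e // e ∈ R}))

include hdr hds hrs hM hsep hB hR h𝔉K h𝔉r h𝔉s h𝔉cl h𝔉d h𝔉nl in
/-- **No `W`-link at any point of the product fibre**: the `W`-cluster of `r` consists of `r`
and the switched blocks rooted at `r`, which have no edge to `s`. -/
lemma not_conn_compl_rs_prod_T (hne : r ≠ s) :
    ¬ Conn ends (OneColourSwitch.compl (flipTouch (endsD ends d)
      {x : V | ∃ c : {C // C ∈ 𝔉}, Sum.inl c ∈ S ∧ x ∈ c.1}
      (fun e => if h : e ∈ R then decide (Sum.inr ⟨e, h⟩ ∈ S) else ρ e))) r s := by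
  set Sw := {x : V | ∃ c : {C // C ∈ 𝔉}, Sum.inl c ∈ S ∧ x ∈ c.1} with hSw
  set ω := flipTouch (endsD ends d) Sw
    (fun e => if h : e ∈ R then decide (Sum.inr ⟨e, h⟩ ∈ S) else ρ e) with hω
  have hsepD := sep2_endsD_of_sep2 (d := d) hsep
  have hSwK := switched_subset_K2 (ρ := ρ) (r := r) (s := s) (d := d) (R := R) h𝔉K S
  intro h
  have key : s ∈ {z | z = r ∨ ∃ c : {C // C ∈ 𝔉}, Sum.inl c ∈ S ∧ z ∈ c.1 ∧
      ∀ e y, y ∈ c.1 → ends e ≠ s(s, y)} := by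
    refine mem_of_conn_of_closed ?_ (Or.inl rfl) h
    rintro a ha b hab
    obtain ⟨hne', e, he, hends⟩ := openGraph_adj.1 hab
    have he' : ω e = false := by
      simp only [OneColourSwitch.compl, Bool.not_eq_true'] at he; exact he
    simp only [Set.mem_setOf_eq] at ha ⊢
    rcases ha with rfl | ⟨c, hcS, hac, hcs⟩
    · -- from `r`: into a switched block (then it has an `r`-edge, hence no `s`-edge), or
      -- a fixed `W` edge into `M₂(G − d) = {r, s}` — impossible
      by_cases hbSw : b ∈ Sw
      · obtain ⟨c, hcS, hbc⟩ := hbSw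
        refine Or.inr ⟨c, hcS, hbc, ?_⟩
        rcases h𝔉nl c.1 c.2 with hc | hc
        · exact (hc e b hbc hends).elim
        · exact hc
      · exfalso
        by_cases hbrs : b = a ∨ b = s
        · rcases hbrs with hb | hb
          · exact hne' hb.symm
          · have : e ∈ within ends ({a, s} : Set V) := ⟨a, by simp, b, by simp [hb], hends⟩
            rw [hrs] at this; exact this
        have hbd : b ≠ d := by
          intro hbd
          rw [hbd] at hends
          have hde : d ∈ ends e := by rw [hends]; exact Sym2.mem_mk_right _ _
          have hnt : e ∉ touches (endsD ends d) Sw := by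
            rintro ⟨z, hz, w, hzw⟩
            rw [endsD_of_mem hde, Sym2.eq_iff] at hzw
            rcases hzw with ⟨h1, _⟩ | ⟨_, h1⟩ <;>
              (rw [← h1] at hz; exact not_mem_K2_endsD hdr hds ρ (hSwK hz))
          have hnR : e ∉ R := fun h => (hR e).1 h ⟨a, Or.inl (Or.inr (r_mem_K2 a s ρ)), d, hends⟩
          have hfix : ω e = ρ e := prod_eq_fixed S hnR hnt
          rw [hfix] at he'
          exact hM (mem_M2_of_closed (r_mem_M2 a s ρ) he' hends)
        have hde : d ∉ ends e := notMem_of_ends_ne hends hdr.symm hbd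
        have hnR : e ∉ R := fun h' => (hR e).1 h' ⟨a, Or.inl (Or.inr (r_mem_K2 a s ρ)), b, hends⟩
        have hnt : e ∉ touches (endsD ends d) Sw := by
          rintro ⟨z, hz, w, hzw⟩
          rw [endsD_of_notMem hde, hends, Sym2.eq_iff] at hzw
          rcases hzw with ⟨h1, _⟩ | ⟨_, h1⟩
          · exact (by rintro ⟨c, _, hr⟩; exact h𝔉r c.1 c.2 hr : a ∉ Sw) (h1 ▸ hz)
          · exact hbSw (h1 ▸ hz)
        rw [hω, prod_eq_fixed S hnR hnt] at he'
        have hbM : b ∈ M2 (endsD ends d) a s ρ :=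
          mem_M2_of_closed (r_mem_M2 a s ρ) he' (by rw [endsD_of_notMem hde, hends])
        rcases hB b hbM with hb | hb
        · exact hbrs (Or.inl hb)
        · exact hbrs (Or.inr hb)
    · -- inside a switched block rooted at `r`: the block, or back to `r`
      have haK : a ∈ K2 (endsD ends d) r s ρ := hSwK ⟨c, hcS, hac⟩
      have had : a ≠ d := by rintro rfl; exact not_mem_K2_endsD hdr hds ρ haK
      have hbd : b ≠ d := by rintro rfl; exact h𝔉d c.1 c.2 e a hac (by rw [hends, Sym2.eq_swap])
      have hde : d ∉ ends e := notMem_of_ends_ne hends had hbd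
      have hnR : e ∉ R := fun h' => (hR e).1 h' ⟨a, Or.inl (Or.inr haK), b, hends⟩
      have ht : e ∈ touches (endsD ends d) Sw := ⟨a, ⟨c, hcS, hac⟩, b, by rw [endsD_of_notMem hde, hends]⟩
      rw [hω, prod_eq_of_touches S hnR ht] at he'
      have hρe : ρ e = true := by
        cases h' : ρ e
        · rw [h'] at he'; exact absurd he' (by decide)
        · rfl
      by_cases hbc : b ∈ c.1
      · exact Or.inr ⟨c, hcS, hbc, hcs⟩
      by_cases hbr : b = r
      · exact Or.inl hbr
      by_cases hbs : b = s
      · exact (hcs e a hac (by rw [hends, hbs, Sym2.eq_swap])).elim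
      exfalso
      have hbK : b ∈ K2 (endsD ends d) r s ρ :=
        mem_K2_of_open haK hρe (by rw [endsD_of_notMem hde, hends])
      exact hbc (Finset.mem_coe.1 (h𝔉cl c.1 c.2 e a b (by rw [endsD_of_notMem hde, hends])
        (Finset.mem_coe.2 hac) ⟨Or.inl hbK, hbr, hbs⟩))
  simp only [Set.mem_setOf_eq] at key
  rcases key with h' | ⟨c, _, hsc, _⟩
  · exact hne h'.symm
  · exact h𝔉s c.1 c.2 hsc

include hdr hds hrs hM hsep hD hK hB hR h𝔉K h𝔉r h𝔉s h𝔉cl h𝔉d h𝔉pk in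
/-- **The `Y`-link at `φ S` is a `Y`-link at `ρ`**: a `Y`-path from `r` at `φ S` stays in
`Z(S)`, where every edge is fixed. -/
lemma conn_rs_of_conn_rs_prod_T
    (h : Conn ends (flipTouch (endsD ends d)
      {x : V | ∃ c : {C // C ∈ 𝔉}, Sum.inl c ∈ S ∧ x ∈ c.1}
      (fun e => if h : e ∈ R then decide (Sum.inr ⟨e, h⟩ ∈ S) else ρ e)) r s) :
    Conn ends ρ r s := by
  set Sw := {x : V | ∃ c : {C // C ∈ 𝔉}, Sum.inl c ∈ S ∧ x ∈ c.1} with hSw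
  set ω := flipTouch (endsD ends d) Sw
    (fun e => if h : e ∈ R then decide (Sum.inr ⟨e, h⟩ ∈ S) else ρ e) with hω
  have hZ := K2_prod_subset_T hdr hds hrs hM hsep hD hB hR h𝔉K h𝔉r h𝔉s h𝔉cl h𝔉d h𝔉pk S
  have hSwK := switched_subset_K2 (ρ := ρ) (r := r) (s := s) (d := d) (R := R) h𝔉K S
  have key : s ∈ {z | Conn ends ω r z ∧ Conn ends ρ r z} := by
    refine mem_of_conn_of_closed ?_ ⟨conn_refl _ _ _, conn_refl _ _ _⟩ h
    rintro a ⟨hac', hac⟩ b hab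
    obtain ⟨hne, e, he, hends⟩ := openGraph_adj.1 hab
    have hbc' : Conn ends ω r b := conn_trans hac' (conn_of_openAdj ⟨e, he, hends⟩)
    refine ⟨hbc', conn_trans hac (conn_of_openAdj ⟨e, ?_, hends⟩)⟩
    -- both endpoints lie in `Z(S)`: the edge is fixed
    have haZ := hZ (mem_K2_iff.2 (Or.inl hac'))
    have hbZ := hZ (mem_K2_iff.2 (Or.inl hbc'))
    simp only [Set.mem_setOf_eq] at haZ hbZ
    have hU : ∀ z, ((z ∈ K2 (endsD ends d) r s ρ ∧ z ∉ Sw) ∨ z = d ∨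
        (z ∈ cluster ends ρ d ∧ z ∉ K2 (endsD ends d) r s ρ ∧ z ∉ M2 (endsD ends d) r s ρ)) →
        z ∈ cluster ends ρ d ∪ K2 (endsD ends d) r s ρ ∪ M2 (endsD ends d) r s ρ ∧ z ∉ Sw := by
      rintro z (⟨h1, h2⟩ | h1 | ⟨h1, h2, _⟩)
      · exact ⟨Or.inl (Or.inr h1), h2⟩
      · exact ⟨Or.inl (Or.inl (h1 ▸ mem_cluster_self ends ρ d)),
          fun h' => not_mem_K2_endsD hdr hds ρ (h1 ▸ hSwK h')⟩
      · exact ⟨Or.inl (Or.inl h1), fun h' => h2 (hSwK h')⟩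
    obtain ⟨haU, haSw⟩ := hU a haZ
    obtain ⟨hbU, hbSw⟩ := hU b hbZ
    have hnR : e ∉ R := fun h' => (hR e).1 h' ⟨a, haU, b, hends⟩
    have hnt : e ∉ touches (endsD ends d) Sw := by
      rintro ⟨z, hz, w, hzw⟩
      have hzK := hSwK hz
      have hzd : z ≠ d := by rintro rfl; exact not_mem_K2_endsD hdr hds ρ hzK
      have hde : d ∉ ends e := by
        intro hde
        rw [endsD_of_mem hde, Sym2.eq_iff] at hzw
        rcases hzw with ⟨h1, _⟩ | ⟨_, h1⟩ <;> exact hzd h1.symm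
      rw [endsD_of_notMem hde, hends, Sym2.eq_iff] at hzw
      rcases hzw with ⟨h1, _⟩ | ⟨_, h1⟩
      · exact haSw (h1 ▸ hz)
      · exact hbSw (h1 ▸ hz)
    rw [hω, prod_eq_fixed S hnR hnt] at he
    exact he
  exact key.2

include hdr hds hrs hM hsep hD hK hB hR h𝔉K h𝔉r h𝔉s h𝔉cl h𝔉d h𝔉pk h𝔉nl in
/-- **The `Y`-link at `ρ` survives at `φ S`**: a `Y`-path from `r` at `ρ` enters a switched
block only through a root edge and, the block being non-linking, can only leave it through
the same root — the detour is shortcut. -/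
lemma conn_rs_prod_of_conn_rs_T (h : Conn ends ρ r s) :
    Conn ends (flipTouch (endsD ends d)
      {x : V | ∃ c : {C // C ∈ 𝔉}, Sum.inl c ∈ S ∧ x ∈ c.1}
      (fun e => if h : e ∈ R then decide (Sum.inr ⟨e, h⟩ ∈ S) else ρ e)) r s := by
  set Sw := {x : V | ∃ c : {C // C ∈ 𝔉}, Sum.inl c ∈ S ∧ x ∈ c.1} with hSw
  set ω := flipTouch (endsD ends d) Sw
    (fun e => if h : e ∈ R then decide (Sum.inr ⟨e, h⟩ ∈ S) else ρ e) with hω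
  have hSwK := switched_subset_K2 (ρ := ρ) (r := r) (s := s) (d := d) (R := R) h𝔉K S
  have hSws : s ∉ Sw := by rintro ⟨c, _, hs⟩; exact h𝔉s c.1 c.2 hs
  have hSwr : r ∉ Sw := by rintro ⟨c, _, hr⟩; exact h𝔉r c.1 c.2 hr
  -- the `Y`-cluster of `r` at `ρ` lies in `U`
  have hclU := cluster_subset_U hdr hds hB (z := r) (Or.inl (Or.inr (r_mem_K2 r s ρ)))
  have key : s ∈ {z | Conn ends ρ r z ∧ (z ∉ Sw → Conn ends ω r z) ∧
      (z ∈ Sw → ∃ t, (t = r ∨ t = s) ∧ Conn ends ω r t ∧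
        ∃ c : {C // C ∈ 𝔉}, Sum.inl c ∈ S ∧ z ∈ c.1 ∧ ∃ e y, y ∈ c.1 ∧ ends e = s(t, y))} := by
    refine mem_of_conn_of_closed ?_ ⟨conn_refl _ _ _, fun _ => conn_refl _ _ _,
      fun h' => (hSwr h').elim⟩ h
    rintro a ⟨hra, ha1, ha2⟩ b hab
    obtain ⟨hne, e, he, hends⟩ := openGraph_adj.1 hab
    have hrb : Conn ends ρ r b := conn_trans hra (conn_of_openAdj ⟨e, he, hends⟩)
    have haU : a ∈ cluster ends ρ d ∪ K2 (endsD ends d) r s ρ ∪ M2 (endsD ends d) r s ρ :=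
      hclU hra
    refine ⟨hrb, ?_, ?_⟩
    · -- `b` not switched
      intro hbSw
      by_cases haSw : a ∈ Sw
      · -- leaving a switched block: `b` is a root `t`, the block being non-linking, `t` is
        -- the root through which the block was entered
        obtain ⟨t, ht, hrt, c, hcS, hac, e', y, hyc, he'⟩ := ha2 haSw
        have haK : a ∈ K2 (endsD ends d) r s ρ := hSwK haSw
        have had : a ≠ d := by rintro rfl; exact not_mem_K2_endsD hdr hds ρ haK
        have hbd : b ≠ d := by rintro rfl; exact h𝔉d c.1 c.2 e a hac (by rw [hends, Sym2.eq_swap])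
        have hde : d ∉ ends e := notMem_of_ends_ne hends had hbd
        have hbK : b ∈ K2 (endsD ends d) r s ρ :=
          mem_K2_of_open haK he (by rw [endsD_of_notMem hde, hends])
        by_cases hbrs : b = r ∨ b = s
        · -- `b = t` by non-linking
          have hbt : b = t := by
            rcases h𝔉nl c.1 c.2 with hc | hc
            · -- no `r`-edge: then `t = s` and `b = s`
              have ht' : t = s := by
                rcases ht with rfl | rfl
                · exact (hc e' y hyc he').elim
                · rfl
              rcases hbrs with hb | hb
              · exact (hc e a hac (by rw [hends, hb, Sym2.eq_swap])).elim
              · rw [hb, ht']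
            · have ht' : t = r := by
                rcases ht with rfl | rfl
                · rfl
                · exact (hc e' y hyc he').elim
              rcases hbrs with hb | hb
              · rw [hb, ht']
              · exact (hc e a hac (by rw [hends, hb, Sym2.eq_swap])).elim
          rw [hbt]; exact hrt
        · -- `b` sided, adjacent to the block: in the block — contradiction with `b ∉ Sw`
          exfalso
          exact hbSw ⟨c, hcS, Finset.mem_coe.1 (h𝔉cl c.1 c.2 e a b
            (by rw [endsD_of_notMem hde, hends]) (Finset.mem_coe.2 hac)
            ⟨Or.inl hbK, fun h' => hbrs (Or.inl h'), fun h' => hbrs (Or.inr h')⟩)⟩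
      · -- a fixed edge between unswitched vertices of `U`
        have hra' := ha1 haSw
        refine conn_trans hra' (conn_of_openAdj ⟨e, ?_, hends⟩)
        have hnR : e ∉ R := fun h' => (hR e).1 h' ⟨a, haU, b, hends⟩
        have hnt : e ∉ touches (endsD ends d) Sw := by
          rintro ⟨z, hz, w, hzw⟩
          have hzK := hSwK hz
          have hzd : z ≠ d := by rintro rfl; exact not_mem_K2_endsD hdr hds ρ hzK
          have hde : d ∉ ends e := by
            intro hde
            rw [endsD_of_mem hde, Sym2.eq_iff] at hzw
            rcases hzw with ⟨h1, _⟩ | ⟨_, h1⟩ <;> exact hzd h1.symm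
          rw [endsD_of_notMem hde, hends, Sym2.eq_iff] at hzw
          rcases hzw with ⟨h1, _⟩ | ⟨_, h1⟩
          · exact haSw (h1 ▸ hz)
          · exact hbSw (h1 ▸ hz)
        rw [hω, prod_eq_fixed S hnR hnt]
        exact he
    · -- `b` switched, in the block `c`
      rintro ⟨c, hcS, hbc⟩
      by_cases haSw : a ∈ Sw
      · -- inside the block (the blocks are closed and `a ∈ Sw` means `a` is in a block of `S`)
        obtain ⟨t, ht, hrt, c', hcS', hac', hroot⟩ := ha2 haSw
        -- `a` and `b` are in the same block: `b ∈ c'` by closedness, and then `c' = c` is not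
        -- needed — we give the witness `c'`
        have haK : a ∈ K2 (endsD ends d) r s ρ := hSwK ⟨c', hcS', hac'⟩
        have had : a ≠ d := by rintro rfl; exact not_mem_K2_endsD hdr hds ρ haK
        have hbK : b ∈ K2 (endsD ends d) r s ρ := hSwK ⟨c, hcS, hbc⟩
        have hbd : b ≠ d := by rintro rfl; exact not_mem_K2_endsD hdr hds ρ hbK
        have hde : d ∉ ends e := notMem_of_ends_ne hends had hbd
        have hbr : b ≠ r := by rintro rfl; exact h𝔉r c.1 c.2 hbc
        have hbs : b ≠ s := by rintro rfl; exact h𝔉s c.1 c.2 hbc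
        have hbc' : b ∈ c'.1 := Finset.mem_coe.1 (h𝔉cl c'.1 c'.2 e a b
          (by rw [endsD_of_notMem hde, hends]) (Finset.mem_coe.2 hac') ⟨Or.inl hbK, hbr, hbs⟩)
        exact ⟨t, ht, hrt, c', hcS', hbc', hroot⟩
      · -- entering the block through its root `a ∈ {r, s}`
        have hra' := ha1 haSw
        have hbK : b ∈ K2 (endsD ends d) r s ρ := hSwK ⟨c, hcS, hbc⟩
        have hbd : b ≠ d := by rintro rfl; exact not_mem_K2_endsD hdr hds ρ hbK
        by_cases hars : a = r ∨ a = s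
        · exact ⟨a, hars, hra', c, hcS, hbc, e, b, hbc, hends⟩
        · exfalso
          -- `a` is sided (closedness puts it in the block), `d`, or in the cluster (`h𝔉pk`)
          rcases haU with (haC | haK) | haM
          · by_cases had : a = d
            · subst a
              exact h𝔉d c.1 c.2 e b hbc hends
            · have hde : d ∉ ends e := notMem_of_ends_ne hends had hbd
              rcases h𝔉pk c.1 c.2 e b a (by rw [hends, Sym2.eq_swap]) hbc haC with h' | h' | h'
              · exact haSw ⟨c, hcS, h'⟩
              · exact hars (Or.inl h')
              · exact hars (Or.inr h')
          · have had : a ≠ d := by rintro rfl; exact not_mem_K2_endsD hdr hds ρ haK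
            have hde : d ∉ ends e := notMem_of_ends_ne hends had hbd
            exact haSw ⟨c, hcS, Finset.mem_coe.1 (h𝔉cl c.1 c.2 e b a
              (by rw [endsD_of_notMem hde, hends, Sym2.eq_swap]) (Finset.mem_coe.2 hbc)
              ⟨Or.inl haK, fun h' => hars (Or.inl h'), fun h' => hars (Or.inr h')⟩)⟩
          · exact hars (hB a haM)
  exact key.2.1 hSws

include hdr hds hrs hM hsep hD hK hB hR h𝔉K h𝔉r h𝔉s h𝔉cl h𝔉d h𝔉pk h𝔉nl in
/-- **`σ_rs` is constant on the product fibre** without linking free blocks. -/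
lemma sigma_rs_prod_eq_T :
    sigma ends (flipTouch (endsD ends d)
      {x : V | ∃ c : {C // C ∈ 𝔉}, Sum.inl c ∈ S ∧ x ∈ c.1}
      (fun e => if h : e ∈ R then decide (Sum.inr ⟨e, h⟩ ∈ S) else ρ e)) r s =
      sigma ends ρ r s := by
  by_cases hne : r = s
  · subst hne
    simp only [sigma, if_pos (conn_refl _ _ _)]
  have hW := not_conn_compl_rs_prod_T hdr hds hrs hM hsep hB hR h𝔉K h𝔉r h𝔉s h𝔉cl h𝔉d h𝔉nl S hne
  have hWρ : ¬ Conn ends (OneColourSwitch.compl ρ) r s := by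
    intro h'
    have h0 : ∀ e ∈ touches ends (cluster ends ρ d ∪ K2 (endsD ends d) r s ρ ∪
        M2 (endsD ends d) r s ρ), ρ e = ρ e := fun _ _ => rfl
    have := cluster_compl_mark_eq_singleton_T hdr hds hrs hM hB h0 (Or.inl rfl)
    have hs : s ∈ cluster ends (OneColourSwitch.compl ρ) r := h'
    rw [this] at hs
    exact hne hs.symm
  simp only [sigma, if_neg hW, if_neg hWρ]
  by_cases hY : Conn ends ρ r s
  · rw [if_pos hY, if_pos (conn_rs_prod_of_conn_rs_T hdr hds hrs hM hsep hD hK hB hR h𝔉K h𝔉r h𝔉s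
      h𝔉cl h𝔉d h𝔉pk h𝔉nl S hY)]
  · rw [if_neg hY, if_neg (fun h' => hY (conn_rs_of_conn_rs_prod_T hdr hds hrs hM hsep hD hK hB hR
      h𝔉K h𝔉r h𝔉s h𝔉cl h𝔉d h𝔉pk S h'))]

end Link

end NoPocket

end Summit.Ventures.PercRepro2
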